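import Mathlib
import Summits.CriticalPhenomena.PercolationContinuityZ3.Theorems.PercNearOneGluingNearOneGluingLaminar
import HarnessLib

/-!
# `NoHeavyLowerTail` (stmt-CriticalPhenomena-4575) — the LAMINAR THEOREM from the chain budget and
# unsplittability alone (abstract form): laminar pocket families carry at most `t + 3√δ₀`

Support file (hull-port / coupling seat `prim-hp-1` gen 5, for the lead's pocket-mass calculus LEAD-GEN5 §4;
`--supports stmt-CriticalPhenomena-4575`).  No definitions, no named facts, no sorries.  Companion of the
4574 file `…NearOneGluingLaminar.lean` (`laminar_mass_le`, budgets T1/T2 with a `log(1/δ)` factor); here the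
two budgets are the ones the 4575 cell uses, both PERCOLATION THEOREMS already in the tree:

Abstract data: a finite ground set `A` (the relays), masses `m S ≥ 0` on subsets (`m S` = `P(π(o) = S)` for the
small pockets `S`), the REGION MASS `e B = Σ_{∅≠S⊆B} m S` (= `P(∅ ≠ π(o) ⊆ B)`), and
* (P1, chain budget) `Σ_{S∈𝒞} m S ≤ t` for every CHAIN `𝒞` of nonempty subsets of `A` (the events
  `{π(o) = S}`, `S ∈ 𝒞`, are disjoint and all lie in `{a ↮ a'}`, `a ∈ ⋂𝒞`, `a' ∉ ⋃𝒞`; pair reliability);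
* (P5, unsplittability) `e B₁ · e B₂ ≤ δ₀` for DISJOINT regions `B₁, B₂ ⊆ A` (van den Berg–Kahn 2001, tree
  `pocketDF_mul_le_of_disjoint`: `P(∅≠π⊆B₁)·P(∅≠π⊆B₂) ≤ P(o ↮ A) = δ₀`).
Conclusion (`laminar_mass_le_of_chain_unsplit`): every laminar family `𝓛` (any two members nested or
disjoint) of nonempty subsets of `A` has `Σ_{S∈𝓛} m S ≤ t + 3√δ₀` — k-free.

Proof (shorter than LEAD-GEN5 §4's dominant-chain argument).  Threshold `τ = √δ₀`.  HEAVY members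
(`e S > τ`) are pairwise NESTED — two disjoint heavy members would have `e S · e T > δ₀`, against (P5) — so
they form a chain and carry `≤ t` by (P1).  LIGHT members lie in maximal light members, which are pairwise
disjoint regions `T_j` with `e T_j ≤ τ`; the light mass is `≤ T := Σ_j e T_j`.  Split `{T_j}` into two groups
with mass difference `≤ τ` (greedy, `exists_balanced_split`); the two unions are disjoint regions whose masses
dominate the group sums (superadditivity of `e`), so (P5) gives `P₁ P₂ ≤ δ₀`, and
`T² = 4 P₁ P₂ + (P₁ − P₂)² ≤ 5 δ₀`, i.e. `T ≤ √5 · √δ₀ ≤ 3√δ₀`.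
USE (lead): no laminar / hierarchical / blob-chain pocket family can be a counterexample family for the crux
(bad mass on it is `≤ t + 3√δ₀`); counterexample mass must sit on genuinely crossing pockets.
-/

namespace Summit.CriticalPhenomena.PercolationContinuityZ3.Theorems

open scoped BigOperators
open Finset

section LaminarUnsplit

variable {α : Type*} [DecidableEq α]

/-- **Balanced split.** Nonnegative reals `x i ≤ τ` on a finset can be split into two groups whose sums differ
by at most `τ` (put each item on the lighter side). [folklore] -/
theorem exists_balanced_split {ι : Type*} [DecidableEq ι] (s : Finset ι) (x : ι → ℝ) (τ : ℝ) (hτ : 0 ≤ τ)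
    (hx0 : ∀ i ∈ s, 0 ≤ x i) (hxτ : ∀ i ∈ s, x i ≤ τ) :
    ∃ s₁ ⊆ s, |∑ i ∈ s₁, x i - ∑ i ∈ s \ s₁, x i| ≤ τ := by
  classical
  induction s using Finset.induction_on with
  | empty => exact ⟨∅, Finset.Subset.refl _, by simp [hτ]⟩
  | @insert a s ha ih =>
    obtain ⟨s₁, hs₁, hbal⟩ := ih (fun i hi => hx0 i (mem_insert_of_mem hi))
      (fun i hi => hxτ i (mem_insert_of_mem hi))
    have ha0 := hx0 a (mem_insert_self a s)
    have haτ := hxτ a (mem_insert_self a s)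
    have ha1 : a ∉ s₁ := fun h => ha (hs₁ h)
    have ha2 : a ∉ s \ s₁ := fun h => ha (mem_sdiff.1 h).1
    set P := ∑ i ∈ s₁, x i with hP
    set Q := ∑ i ∈ s \ s₁, x i with hQ
    by_cases hd : 0 ≤ P - Q
    · -- put `a` on the second side
      refine ⟨s₁, hs₁.trans (subset_insert a s), ?_⟩
      have hsd : insert a s \ s₁ = insert a (s \ s₁) := by
        ext i
        simp only [mem_sdiff, mem_insert]
        constructor
        · rintro ⟨h1 | h1, h2⟩
          · exact Or.inl h1
          · exact Or.inr ⟨h1, h2⟩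
        · rintro (h1 | ⟨h1, h2⟩)
          · exact ⟨Or.inl h1, h1 ▸ ha1⟩
          · exact ⟨Or.inr h1, h2⟩
      rw [hsd, sum_insert ha2]
      rw [abs_le] at hbal ⊢
      constructor <;> linarith [hbal.1, hbal.2]
    · -- put `a` on the first side
      refine ⟨insert a s₁, insert_subset_insert a hs₁, ?_⟩
      have hsd : insert a s \ insert a s₁ = s \ s₁ := by
        ext i
        simp only [mem_sdiff, mem_insert, not_or]
        constructor
        · rintro ⟨h1 | h1, h2, h3⟩
          · exact absurd h1 h2
          · exact ⟨h1, h3⟩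
        · rintro ⟨h1, h3⟩
          exact ⟨Or.inr h1, fun h => ha (h ▸ h1), h3⟩
      rw [hsd, sum_insert ha1]
      rw [abs_le] at hbal ⊢
      push Not at hd
      constructor <;> linarith [hbal.1, hbal.2]

/-- **The laminar theorem from the chain budget and unsplittability (abstract form).**  Masses `m ≥ 0` on the
subsets of a finite ground set `A`, region mass `e B = Σ_{∅≠S⊆B} m S`; if every chain of nonempty subsets carries
`≤ t` (P1) and `e B₁ · e B₂ ≤ δ₀` for disjoint regions (P5), then every laminar family of nonempty subsets of
`A` carries at most `t + 3 √δ₀`.  [cite: VandenbergKahn2001, Thm. 1.2 (source of P5); KozmaNitzan2024, Conj. 3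
(p. 15) — context] -/
theorem laminar_mass_le_of_chain_unsplit (A : Finset α) (m : Finset α → ℝ) (hm0 : ∀ S, 0 ≤ m S)
    (t δ₀ : ℝ) (hδ : 0 ≤ δ₀)
    (hP1 : ∀ 𝒞 : Finset (Finset α), (∀ S ∈ 𝒞, S ⊆ A ∧ S.Nonempty) →
      (∀ S ∈ 𝒞, ∀ T ∈ 𝒞, S ⊆ T ∨ T ⊆ S) → ∑ S ∈ 𝒞, m S ≤ t)
    (hP5 : ∀ B₁ B₂ : Finset α, B₁ ⊆ A → B₂ ⊆ A → Disjoint B₁ B₂ →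
      (∑ S ∈ A.powerset.filter (fun S => S.Nonempty ∧ S ⊆ B₁), m S) *
        (∑ S ∈ A.powerset.filter (fun S => S.Nonempty ∧ S ⊆ B₂), m S) ≤ δ₀)
    (𝓛 : Finset (Finset α)) (h𝓛A : ∀ S ∈ 𝓛, S ⊆ A ∧ S.Nonempty)
    (hlam : ∀ S ∈ 𝓛, ∀ T ∈ 𝓛, Disjoint S T ∨ S ⊆ T ∨ T ⊆ S) :
    ∑ S ∈ 𝓛, m S ≤ t + 3 * Real.sqrt δ₀ := by
  classical
  let e : Finset α → ℝ := fun B => ∑ S ∈ A.powerset.filter (fun S => S.Nonempty ∧ S ⊆ B), m S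
  have he0 : ∀ B, 0 ≤ e B := fun B => sum_nonneg fun S _ => hm0 S
  set τ : ℝ := Real.sqrt δ₀ with hτ
  have hτ0 : 0 ≤ τ := Real.sqrt_nonneg _
  have hτsq : τ * τ = δ₀ := Real.mul_self_sqrt hδ
  -- heavy / light split
  let heavy := 𝓛.filter fun S => τ < e S
  let light := 𝓛.filter fun S => e S ≤ τ
  have hsplit : ∑ S ∈ 𝓛, m S = ∑ S ∈ heavy, m S + ∑ S ∈ light, m S := by
    have h := (sum_filter_add_sum_filter_not 𝓛 (fun S => τ < e S) (fun S => m S)).symm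
    have h2 : 𝓛.filter (fun S => ¬ τ < e S) = light := by
      ext S; simp only [light, mem_filter, not_lt]
    rw [h2] at h
    exact h
  have hheavy_𝓛 : ∀ S ∈ heavy, S ∈ 𝓛 := fun S hS => (mem_filter.1 hS).1
  have hlight_𝓛 : ∀ S ∈ light, S ∈ 𝓛 := fun S hS => (mem_filter.1 hS).1
  ------------------------------------------------------------------
  -- HEAVY PART: heavy members are pairwise nested (P5), hence a chain, hence ≤ t (P1)
  ------------------------------------------------------------------
  have hheavy_chain : ∀ S ∈ heavy, ∀ T ∈ heavy, S ⊆ T ∨ T ⊆ S := by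
    intro S hS T hT
    rcases hlam S (hheavy_𝓛 S hS) T (hheavy_𝓛 T hT) with h | h | h
    · exfalso
      have hS' : τ < e S := (mem_filter.1 hS).2
      have hT' : τ < e T := (mem_filter.1 hT).2
      have h5 := hP5 S T (h𝓛A S (hheavy_𝓛 S hS)).1 (h𝓛A T (hheavy_𝓛 T hT)).1 h
      have hlt : τ * τ < e S * e T := mul_lt_mul'' hS' hT' hτ0 hτ0
      linarith
    · exact Or.inl h
    · exact Or.inr h
  have hheavy_final : ∑ S ∈ heavy, m S ≤ t :=
    hP1 heavy (fun S hS => h𝓛A S (hheavy_𝓛 S hS)) hheavy_chain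
  ------------------------------------------------------------------
  -- LIGHT PART ≤ 3 τ
  ------------------------------------------------------------------
  let Lmax := light.filter fun S => ∀ T ∈ light, S ⊆ T → T = S
  have hLmax_light : ∀ S ∈ Lmax, S ∈ light := fun S hS => (mem_filter.1 hS).1
  have hcover' : ∀ S ∈ light, ∃ T ∈ Lmax, S ⊆ T := by
    intro S hS
    obtain ⟨T, hT, hST, hmaximal⟩ := exists_maximal_mem_superset light hS
    exact ⟨T, mem_filter.2 ⟨hT, hmaximal⟩, hST⟩
  have hLmax_disj : ∀ S ∈ Lmax, ∀ T ∈ Lmax, S ≠ T → Disjoint S T := by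
    intro S hS T hT hne
    rcases hlam S (hlight_𝓛 S (hLmax_light S hS)) T (hlight_𝓛 T (hLmax_light T hT)) with h | h | h
    · exact h
    · exact absurd ((mem_filter.1 hS).2 T (hLmax_light T hT) h).symm hne
    · exact absurd ((mem_filter.1 hT).2 S (hLmax_light S hS) h) hne
  have hlight_le : ∑ S ∈ light, m S ≤ ∑ T ∈ Lmax, e T := by
    have h1 : ∑ S ∈ light, m S ≤ ∑ S ∈ light, ∑ T ∈ Lmax.filter (fun T => S ⊆ T), m S := by
      refine sum_le_sum fun S hS => ?_
      obtain ⟨T, hT, hST⟩ := hcover' S hS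
      have hmem : T ∈ Lmax.filter fun T => S ⊆ T := mem_filter.2 ⟨hT, hST⟩
      calc m S = ∑ _T ∈ ({T} : Finset (Finset α)), m S := by simp
        _ ≤ ∑ T ∈ Lmax.filter (fun T => S ⊆ T), m S :=
            sum_le_sum_of_subset_of_nonneg (singleton_subset_iff.2 hmem) fun _ _ _ => hm0 S
    have h2 : ∑ S ∈ light, ∑ T ∈ Lmax.filter (fun T => S ⊆ T), m S =
        ∑ T ∈ Lmax, ∑ S ∈ light.filter (fun S => S ⊆ T), m S := by
      rw [sum_comm' (t' := Lmax) (s' := fun T => light.filter fun S => S ⊆ T)]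
      intro S T
      simp only [mem_filter]
      tauto
    have h3 : ∀ T ∈ Lmax, ∑ S ∈ light.filter (fun S => S ⊆ T), m S ≤ e T := by
      intro T _
      refine sum_le_sum_of_subset_of_nonneg (fun S hS => ?_) fun S _ _ => hm0 S
      have hS' := mem_filter.1 hS
      exact mem_filter.2 ⟨mem_powerset.2 (h𝓛A S (hlight_𝓛 S hS'.1)).1, (h𝓛A S (hlight_𝓛 S hS'.1)).2, hS'.2⟩
    calc ∑ S ∈ light, m S ≤ ∑ T ∈ Lmax, ∑ S ∈ light.filter (fun S => S ⊆ T), m S := h1.trans h2.le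
      _ ≤ ∑ T ∈ Lmax, e T := sum_le_sum h3
  -- superadditivity of `e` over a group of pairwise disjoint regions
  have hsuper : ∀ G : Finset (Finset α), G ⊆ Lmax →
      ∑ T ∈ G, e T ≤ e (G.biUnion id) := by
    intro G hG
    have h2 : ∑ T ∈ G, e T =
        ∑ S ∈ G.biUnion (fun T => A.powerset.filter (fun S => S.Nonempty ∧ S ⊆ T)), m S := by
      rw [sum_biUnion]
      intro T₁ hT₁ T₂ hT₂ hne
      rw [Function.onFun, disjoint_left]
      intro S hS hS'
      have h1' := (mem_filter.1 hS).2
      have h2' := (mem_filter.1 hS').2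
      obtain ⟨x, hx⟩ := h1'.1
      exact disjoint_left.1 (hLmax_disj T₁ (hG hT₁) T₂ (hG hT₂) hne) (h1'.2 hx) (h2'.2 hx)
    have h3 : G.biUnion (fun T => A.powerset.filter (fun S => S.Nonempty ∧ S ⊆ T)) ⊆
        A.powerset.filter (fun S => S.Nonempty ∧ S ⊆ G.biUnion id) := by
      intro S hS
      simp only [mem_biUnion, mem_filter] at hS
      obtain ⟨T, hT, hSA, hSne, hST⟩ := hS
      exact mem_filter.2 ⟨hSA, hSne, hST.trans (subset_biUnion_of_mem id hT)⟩
    rw [h2]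
    exact sum_le_sum_of_subset_of_nonneg h3 fun S _ _ => hm0 S
  have hLmaxA : ∀ G : Finset (Finset α), G ⊆ Lmax → G.biUnion id ⊆ A := by
    intro G hG
    refine biUnion_subset.2 fun T hT => ?_
    exact (h𝓛A T (hlight_𝓛 T (hLmax_light T (hG hT)))).1
  -- balanced split of the maximal light members
  obtain ⟨G₁, hG₁, hbal⟩ := exists_balanced_split Lmax e τ hτ0 (fun T _ => he0 T)
    (fun T hT => (mem_filter.1 (hLmax_light T hT)).2)
  set P₁ := ∑ T ∈ G₁, e T with hP₁
  set P₂ := ∑ T ∈ Lmax \ G₁, e T with hP₂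
  have hP₁0 : 0 ≤ P₁ := sum_nonneg fun T _ => he0 T
  have hP₂0 : 0 ≤ P₂ := sum_nonneg fun T _ => he0 T
  have hTot : ∑ T ∈ Lmax, e T = P₁ + P₂ := by
    rw [hP₁, hP₂, ← sum_union (disjoint_sdiff), union_sdiff_of_subset hG₁]
  have hdisjU : Disjoint (G₁.biUnion id) ((Lmax \ G₁).biUnion id) := by
    rw [disjoint_biUnion_left]
    intro T₁ hT₁
    rw [disjoint_biUnion_right]
    intro T₂ hT₂
    have hne : T₁ ≠ T₂ := fun h => (mem_sdiff.1 hT₂).2 (h ▸ hT₁)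
    exact hLmax_disj T₁ (hG₁ hT₁) T₂ (mem_sdiff.1 hT₂).1 hne
  have hprod : P₁ * P₂ ≤ δ₀ := by
    have h1 : P₁ ≤ e (G₁.biUnion id) := hsuper G₁ hG₁
    have h2 : P₂ ≤ e ((Lmax \ G₁).biUnion id) := hsuper (Lmax \ G₁) sdiff_subset
    have h5 := hP5 (G₁.biUnion id) ((Lmax \ G₁).biUnion id) (hLmaxA G₁ hG₁)
      (hLmaxA (Lmax \ G₁) sdiff_subset) hdisjU
    calc P₁ * P₂ ≤ e (G₁.biUnion id) * e ((Lmax \ G₁).biUnion id) :=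
          mul_le_mul h1 h2 hP₂0 ((he0 _))
      _ ≤ δ₀ := h5
  have hlight_final : ∑ S ∈ light, m S ≤ 3 * τ := by
    have hT : P₁ + P₂ ≤ 3 * τ := by
      -- (P₁+P₂)² = 4 P₁ P₂ + (P₁−P₂)² ≤ 4 δ₀ + τ² = 5 τ² ≤ 9 τ²
      rw [abs_le] at hbal
      nlinarith [hbal.1, hbal.2, hprod, hτsq, hP₁0, hP₂0, hτ0]
    calc ∑ S ∈ light, m S ≤ ∑ T ∈ Lmax, e T := hlight_le
      _ = P₁ + P₂ := hTot
      _ ≤ 3 * τ := hT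
  ------------------------------------------------------------------
  -- assemble
  ------------------------------------------------------------------
  calc ∑ S ∈ 𝓛, m S = ∑ S ∈ heavy, m S + ∑ S ∈ light, m S := hsplit
    _ ≤ t + 3 * τ := add_le_add hheavy_final hlight_final

/-- **The laminar theorem from P1 + P5, registered form** (ground set of relays `A ⊆ Fin n`; see
`laminar_mass_le_of_chain_unsplit` and the module docstring).
[cite: VandenbergKahn2001, Thm. 1.2 (source of P5); KozmaNitzan2024, Conj. 3 (p. 15) — context] -/
theorem laminarMass_of_chain_unsplit : ∀ (n : ℕ) (A : Finset (Fin n)) (m : Finset (Fin n) → ℝ),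
    (∀ S, 0 ≤ m S) → ∀ (t δ₀ : ℝ), 0 ≤ δ₀ →
    (∀ 𝒞 : Finset (Finset (Fin n)), (∀ S ∈ 𝒞, S ⊆ A ∧ S.Nonempty) →
      (∀ S ∈ 𝒞, ∀ T ∈ 𝒞, S ⊆ T ∨ T ⊆ S) → ∑ S ∈ 𝒞, m S ≤ t) →
    (∀ B₁ B₂ : Finset (Fin n), B₁ ⊆ A → B₂ ⊆ A → Disjoint B₁ B₂ →
      (∑ S ∈ A.powerset.filter (fun S => S.Nonempty ∧ S ⊆ B₁), m S) *
        (∑ S ∈ A.powerset.filter (fun S => S.Nonempty ∧ S ⊆ B₂), m S) ≤ δ₀) →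
    ∀ (𝓛 : Finset (Finset (Fin n))), (∀ S ∈ 𝓛, S ⊆ A ∧ S.Nonempty) →
      (∀ S ∈ 𝓛, ∀ T ∈ 𝓛, Disjoint S T ∨ S ⊆ T ∨ T ⊆ S) →
      ∑ S ∈ 𝓛, m S ≤ t + 3 * Real.sqrt δ₀ :=
  fun _ A m hm0 t δ₀ hδ hP1 hP5 𝓛 h𝓛A hlam =>
    laminar_mass_le_of_chain_unsplit A m hm0 t δ₀ hδ hP1 hP5 𝓛 h𝓛A hlam

end LaminarUnsplit

end Summit.CriticalPhenomena.PercolationContinuityZ3.Theorems
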